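import Summits.HodgeConjecture.HodgeConjecture.Statement
import Summits.HodgeConjecture.HodgeConjecture.Theses.RankFourFaces
import Summits.HodgeConjecture.HodgeConjecture.Theses.PadicSemiregularLift
import Summits.HodgeConjecture.HodgeConjecture.Theorems.Ring2ClassTargets
import Literature.AlgebraicGeometry.HodgeTheory.RibetTypeHodgeClasses
import Literature.AlgebraicGeometry.HodgeTheory.RibetTotallyRealHodgeClasses
import Literature.AlgebraicGeometry.HodgeTheory.HodgeConjectureIsogenyInvariance
import HarnessLib

/-!
# Ring 2 · route `motiv` (generation 8) — the RIBET rows: `End⁰(A) = k` imaginary quadratic with coprime multiplicities, or `End⁰(A)` a totally real field of odd relative dimension — all powers, their isogeny class and their factors — `HC_CM` ABSENT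

HONEST FRAMING: research route conditional on HC_CM; not a corollary; Q11.4-sentence-2 already refuted in dim ≥ 3.

Cell `pub-hodge-ring2`, seat `pub-hodge-ring2-motiv-g8`. SUMMIT-SIDE binding of the Literature files
`HodgeTheory/RibetTypeHodgeClasses` (Ribet 1983, Thms. 0 and 3, as the named fact
`Ribet1983_hodgeClasses_divisorial_powers_imaginaryQuadraticCoprime`) and `HodgeTheory/RibetTotallyRealHodgeClasses`
(Ribet 1983, Thms. 0 and 1, as the named fact `Ribet1983_hodgeClasses_divisorial_powers_totallyRealField_oddRelDim`). `HC_CM` is the binder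
`Theses.RankFourFaces.CMAbelianHodge` (item stmt-HodgeConjecture-3052) and `HC_AV` the binder
`Theses.PadicSemiregularLift.HodgeAbelianVarieties` (item stmt-HodgeConjecture-1333), both BY NAME, arguments never facts;
THIS FILE'S ROWS DO NOT USE `HC_CM` AT ALL — that is their point in the cell's census ("(i) classes of abelian varieties
where HC is known unconditionally in print"): KIND of `HC_CM` = ABSENT.

ROWS (class-target currency `Ring2.ClassTargets.HCOnClass` of the cell's kernel):
* §1 `IsRibetTypeWith A φ d` — the typed hypothesis packet (`φ² = -d`, `d > 0`, `finrank_ℚ End⁰(A) = 2`, coprime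
  multiplicities of `±i√d` on `H^{1,0}`), and the isogeny-closed class `RibetTypePowerClass` = "isogenous to a power
  `A^{N+1}` of some abelian variety of Ribet type".
* §2 `hcOnClass_ribetTypePowerClass_of_ribet1983`: the Hodge conjecture ON THAT CLASS, modulo the one print fact
  (Ribet) — powers by the Literature feeder, isogeny by van Geemen's Lemma 3.7 (tree theorem
  `HodgeConjectureFor.of_isIsogenous`); and the FACTOR form (`X × Y ~ A^{N+1}` ⟹ HC(`X`), slice restriction
  `hodgeConjectureFor_left_of_prod`).
* §3 the two atlas factors: the simple fourfold `Y₄` with `End⁰ = k` acting `(1,3)` (factor of the OPEN cell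
  `Ring2.Atlas.HodgePowersOfEllipticTimesFourfold13`) and the simple sixfold `Y₆` with `End⁰ = k` acting `(5,1)`
  (factor of the OPEN cell `Ring2.Atlas.HodgePowersOfCMEllipticTimesUnitarySixfold`): ALL THEIR OWN POWERS have the
  Hodge property modulo Ribet's theorem. The cells themselves (`(E_k × Y)^{N+1}`) stay OPEN: `Hg(E_k × Y)` is not split
  (Moonen–Zarhin 1999 (3.8)), Ribet's theorem says nothing about them, and this file claims nothing about them.
* §4 ON PATH: every row is a case of `HC_AV` and of the summit (bookkeeping, so that nothing here is stronger than the
  Clay statement).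
* §5 the TOTALLY REAL rows (Ribet's Thm. 1): `IsTotallyRealOddWith A hF r` (`End⁰(A)` a totally real field,
  `dim A = e·r`, `r` odd), the isogeny-closed class `TotallyRealOddPowerClass`, `hcOnClass_totallyRealOddPowerClass_of_ribet1983`
  (modulo Ribet's Thm. 1 only), the factor form, and the `g = 5, 6, 7` rows of the cell's table: `End⁰ = ℚ` in odd
  dimension (all powers), sixfolds with real quadratic or totally real sextic `End⁰` (all powers); on path.

References: [Ribet1983] Thms. 0, 1, 3; [Gordon1997] Thms. 6.2–6.3, 5.11 (i) (arXiv:alg-geom/9709030 pp. 17–19);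
[MoonenZarhin1995Duke] type IV(1,1); [MoonenZarhin1999LowDim] Thm. 0.2 (3), (3.8); [vanGeemen1994HodgeAV] Lemma 3.7;
[Deligne2000] §1.
-/

set_option linter.dupNamespace false

noncomputable section

namespace Summit.HodgeConjecture.HodgeConjecture.Ring2.Motiv

open CategoryTheory
open Literature.AlgebraicGeometry Literature.AlgebraicGeometry.Motives
open Literature.AlgebraicGeometry.HodgeTheory
open Summit.HodgeConjecture.HodgeConjecture.Theses
open Summit.HodgeConjecture.HodgeConjecture.Ring2.ClassTargets

/-! ## §1 The typed hypothesis packet and the class -/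

/-- **`A` is of Ribet type, witnessed by `(φ, d)`**: `φ ≫ φ = -d` with `d > 0` (so `ℚ(φ) ≅ ℚ(√-d) ⊆ End⁰(A)`),
`finrank_ℚ End⁰(A) = 2` (so `End⁰(A) = ℚ(φ)` is the imaginary quadratic field `k`), and the multiplicities `n'`, `n''`
of `i√d`, `-i√d` on `H^{1,0}(A)` are coprime (Gordon 1.13.2 / 6.3 third case). A definition (nothing asserted).
[cite: Gordon1997, 1.13.2 and Thm. 6.3] [cite: Ribet1983, Thm. 3] -/
def IsRibetTypeWith (A : AbelianVariety ℂ) (φ : A ⟶ A) (d : ℕ) : Prop :=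
  0 < d ∧ φ ≫ φ = -(d • 𝟙 A) ∧ Module.finrank ℚ A.endAlgebra = 2 ∧
    Nat.Coprime (eigenMultiplicity A φ (Complex.I * (Real.sqrt d : ℂ)))
      (eigenMultiplicity A φ (-(Complex.I * (Real.sqrt d : ℂ))))

/-- **The Ribet-type power class, isogeny-closed**: `X` is isogenous to `A^{N+1}` for some abelian variety `A` of
Ribet type and some `N`. A definition (nothing asserted). [cite: Gordon1997, Thm. 6.3] [cite: vanGeemen1994HodgeAV, Lemma 3.7] -/
def RibetTypePowerClass (X : AbelianVariety ℂ) : Prop :=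
  ∃ (A : AbelianVariety ℂ) (φ : A ⟶ A) (d N : ℕ), IsRibetTypeWith A φ d ∧ AbelianVariety.IsIsogenous X (A.powSucc N)

/-! ## §2 The rows, modulo Ribet's theorem only -/

/-- **Every power of an abelian variety of Ribet type has the Hodge property** (modulo the print fact; the
Literature feeder `hodgeConjectureFor_powSucc_of_ribet1983` on the packet). KIND of `HC_CM`: ABSENT.
[cite: Ribet1983, Thms. 0 and 3] [cite: Gordon1997, Thms. 6.2–6.3] -/
theorem hodgeConjectureFor_powSucc_of_isRibetTypeWith
    (hR : Ribet1983_hodgeClasses_divisorial_powers_imaginaryQuadraticCoprime)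
    {A : AbelianVariety ℂ} {φ : A ⟶ A} {d : ℕ} (hA : IsRibetTypeWith A φ d) (N : ℕ) :
    HodgeConjectureFor (A.powSucc N).dim (A.powSucc N).X :=
  hodgeConjectureFor_powSucc_of_ribet1983 hR A φ hA.1 hA.2.1 hA.2.2.1 hA.2.2.2 N

/-- **ROW: the Hodge conjecture on the Ribet-type power class** (isogeny-closed), modulo Ribet's theorem — powers by
the feeder, the isogeny by van Geemen's Lemma 3.7 (`HodgeConjectureFor.of_isIsogenous`, a tree theorem). In the cell's
class-target currency `HCOnClass`. KIND of `HC_CM`: ABSENT. [cite: Ribet1983, Thms. 0 and 3]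
[cite: vanGeemen1994HodgeAV, Lemma 3.7] [cite: Deligne2000, §1] -/
theorem hcOnClass_ribetTypePowerClass_of_ribet1983
    (hR : Ribet1983_hodgeClasses_divisorial_powers_imaginaryQuadraticCoprime) : HCOnClass RibetTypePowerClass := by
  rintro X ⟨A, φ, d, N, hA, hX⟩
  exact HodgeConjectureFor.of_isIsogenous hX (hodgeConjectureFor_powSucc_of_isRibetTypeWith hR hA N)

/-- **FACTOR form**: if `X × Y` is isogenous to a power `A^{N+1}` of an abelian variety of Ribet type, then HC(`X`)
(restriction to the slice `X × {0}`, `hodgeConjectureFor_left_of_prod`) — e.g. the abelian subvarieties of `A^{N+1}` up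
to isogeny (Poincaré reducibility supplies the complement `Y`). [cite: Ribet1983, Thms. 0 and 3]
[cite: vanGeemen1994HodgeAV, Lemma 3.7] -/
theorem hodgeConjectureFor_of_prod_isIsogenous_powSucc_of_ribet1983
    (hR : Ribet1983_hodgeClasses_divisorial_powers_imaginaryQuadraticCoprime) (X Y : AbelianVariety ℂ)
    {A : AbelianVariety ℂ} {φ : A ⟶ A} {d : ℕ} (hA : IsRibetTypeWith A φ d) (N : ℕ)
    (hXY : AbelianVariety.IsIsogenous (X.prod Y) (A.powSucc N)) : HodgeConjectureFor X.dim X.X :=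
  hodgeConjectureFor_left_of_prod X Y
    (hcOnClass_ribetTypePowerClass_of_ribet1983 hR (X.prod Y) ⟨A, φ, d, N, hA, hXY⟩)

/-! ## §3 The two atlas factors: `Y₄` of `k`-signature `(1,3)` and `Y₆` of `k`-signature `(5,1)` -/

/-- **Signature `(g-1,1)` is Ribet type**: multiplicity `1` at one of `±i√d` makes the pair `(g-1,1)` (the sum is
`dim A`, tree theorem `eigenMultiplicity_add_eigenMultiplicity_neg_eq_dim`), which is coprime.
[cite: Gordon1997, 1.13.2 and 5.11 (i)] -/
theorem isRibetTypeWith_of_eigenMultiplicity_eq_one {A : AbelianVariety ℂ} {φ : A ⟶ A} {d : ℕ} (hd : 0 < d)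
    (hφ : φ ≫ φ = -(d • 𝟙 A)) (hE : Module.finrank ℚ A.endAlgebra = 2)
    (h1 : eigenMultiplicity A φ (Complex.I * (Real.sqrt d : ℂ)) = 1 ∨
      eigenMultiplicity A φ (-(Complex.I * (Real.sqrt d : ℂ))) = 1) : IsRibetTypeWith A φ d := by
  refine ⟨hd, hφ, hE, ?_⟩
  rcases h1 with h1 | h1
  · rw [h1]; exact Nat.coprime_one_left _
  · rw [h1]; exact Nat.coprime_one_right _

/-- **The factor `Y₄` of the OPEN cell `Ring2.Atlas.HodgePowersOfEllipticTimesFourfold13`, when `End⁰(Y₄) = k`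
(`finrank = 2`, the type IV(1,1) case of MZ99 (g)): all powers `Y₄^{N+1}` have the Hodge property modulo Ribet's
theorem** (Moonen–Zarhin 1995: "`hg = u(W/K)`, and `Hdg(Aⁿ) = Div(Aⁿ)` for all `n`"; Gordon 5.11 (i): "`A` is of Ribet
type"). The hypotheses are the cell's on `Y` (`ψ² = -d`, multiplicity `1` at one sign) plus `finrank_ℚ End⁰(Y) = 2`;
the cell itself concerns `(E × Y)^{N+1}` and is NOT touched. [cite: MoonenZarhin1995Duke, type IV(1,1) (i)]
[cite: Gordon1997, 5.11 (i) and Thm. 6.3] [cite: Ribet1983, Thms. 0 and 3] -/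
theorem hodgeConjectureFor_powSucc_fourfold13Factor_of_ribet1983
    (hR : Ribet1983_hodgeClasses_divisorial_powers_imaginaryQuadraticCoprime)
    (Y : AbelianVariety ℂ) (ψ : Y ⟶ Y) {d : ℕ} (hd : 0 < d) (_hY : Y.dim = 4) (hψ : ψ ≫ ψ = -(d • 𝟙 Y))
    (hE : Module.finrank ℚ Y.endAlgebra = 2)
    (h1 : eigenMultiplicity Y ψ (Complex.I * (Real.sqrt d : ℂ)) = 1 ∨
      eigenMultiplicity Y ψ (-(Complex.I * (Real.sqrt d : ℂ))) = 1) (N : ℕ) :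
    HodgeConjectureFor (Y.powSucc N).dim (Y.powSucc N).X :=
  hodgeConjectureFor_powSucc_of_isRibetTypeWith hR (isRibetTypeWith_of_eigenMultiplicity_eq_one hd hψ hE h1) N

/-- **The factor `Y₆` of `k`-signature `(5,1)` of the OPEN cell `Ring2.Atlas.HodgePowersOfCMEllipticTimesUnitarySixfold`,
when `End⁰(Y₆) = k`: all powers `Y₆^{N+1}` have the Hodge property modulo Ribet's theorem** (multiplicity `5` at one
sign forces `1` at the other: `n' + n'' = 6`). This is INPUT (i) of the cell's census rows `E_k × Y₆(5,1)` made print: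
Ribet's Thm. 3 gives `Hg(Y₆) = Lf(Y₆) = U_k(H¹, ψ)` (the engines' assumption) and Thm. 0 the classes on the powers.
The cell itself (`(E_k × Y₆)^{N+1}`) is NOT touched. [cite: Ribet1983, Thms. 0 and 3] [cite: Gordon1997, Thm. 6.3] -/
theorem hodgeConjectureFor_powSucc_sixfold51Factor_of_ribet1983
    (hR : Ribet1983_hodgeClasses_divisorial_powers_imaginaryQuadraticCoprime)
    (Y : AbelianVariety ℂ) (ψ : Y ⟶ Y) {d : ℕ} (hd : 0 < d) (hY : Y.dim = 6) (hψ : ψ ≫ ψ = -(d • 𝟙 Y))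
    (hE : Module.finrank ℚ Y.endAlgebra = 2)
    (h5 : eigenMultiplicity Y ψ (Complex.I * (Real.sqrt d : ℂ)) = 5 ∨
      eigenMultiplicity Y ψ (-(Complex.I * (Real.sqrt d : ℂ))) = 5) (N : ℕ) :
    HodgeConjectureFor (Y.powSucc N).dim (Y.powSucc N).X :=
  hodgeConjectureFor_powSucc_sixfold_fiveOne_of_ribet1983 hR Y ψ hd hY hψ hE h5 N

/-! ## §4 On path: every row is a case of `HC_AV` and of the summit -/

/-- ON-PATH: the Ribet-type power class row is a case of `HC_AV` (stmt-HodgeConjecture-1333 by name).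
[cite: Deligne2000, §1] -/
theorem hcOnClass_ribetTypePowerClass_of_hodgeAbelianVarieties (h : PadicSemiregularLift.HodgeAbelianVarieties) :
    HCOnClass RibetTypePowerClass :=
  fun X _ ↦ h X

/-- ON-PATH: … and of the summit. [cite: Deligne2000, §1] -/
theorem hcOnClass_ribetTypePowerClass_of_hodgeConjecture (h : _root_.HodgeConjecture) :
    HCOnClass RibetTypePowerClass :=
  fun X _ ↦ h (AbelianVariety.isSmoothProjective_holds (A := X))


/-! ## §5 The totally real rows (Ribet's Thm. 1): `End⁰(A)` a totally real field, odd relative dimension -/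

/-- **`End⁰(A)` is a totally real field and `dim A = [End⁰(A):ℚ]·r` with `r` odd, witnessed by `(hF, r)`**
(Gordon 6.3 first case; type I of odd relative dimension, Gordon 7.9). A definition (nothing asserted).
[cite: Gordon1997, Thm. 6.3 and 7.9] [cite: Ribet1983, Thm. 1] -/
def IsTotallyRealOddWith (A : AbelianVariety ℂ) (hF : IsField A.endAlgebra) (r : ℕ) : Prop :=
  NumberField.IsTotallyReal (ComplexMultiplication.EndField A hF) ∧ A.dim = Module.finrank ℚ A.endAlgebra * r ∧ Odd r

/-- **The totally-real odd power class, isogeny-closed**: `X ~ A^{N+1}` for some `A` whose endomorphism algebra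
is a totally real field of odd relative dimension. A definition (nothing asserted). [cite: Gordon1997, Thm. 6.3]
[cite: vanGeemen1994HodgeAV, Lemma 3.7] -/
def TotallyRealOddPowerClass (X : AbelianVariety ℂ) : Prop :=
  ∃ (A : AbelianVariety ℂ) (hF : IsField A.endAlgebra) (r N : ℕ),
    IsTotallyRealOddWith A hF r ∧ AbelianVariety.IsIsogenous X (A.powSucc N)

/-- **Every power has the Hodge property**, modulo Ribet's Thm. 1 (Literature feeder
`hodgeConjectureFor_powSucc_of_ribet1983_totallyReal`). KIND of `HC_CM`: ABSENT. [cite: Ribet1983, Thms. 0 and 1]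
[cite: Gordon1997, Thms. 6.2–6.3] -/
theorem hodgeConjectureFor_powSucc_of_isTotallyRealOddWith
    (hR : Ribet1983_hodgeClasses_divisorial_powers_totallyRealField_oddRelDim)
    {A : AbelianVariety ℂ} {hF : IsField A.endAlgebra} {r : ℕ} (hA : IsTotallyRealOddWith A hF r) (N : ℕ) :
    HodgeConjectureFor (A.powSucc N).dim (A.powSucc N).X :=
  hodgeConjectureFor_powSucc_of_ribet1983_totallyReal hR A hF hA.1 hA.2.1 hA.2.2 N

/-- **ROW: the Hodge conjecture on the totally-real odd power class** (isogeny-closed), modulo Ribet's Thm. 1.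
KIND of `HC_CM`: ABSENT. [cite: Ribet1983, Thms. 0 and 1] [cite: vanGeemen1994HodgeAV, Lemma 3.7] [cite: Deligne2000, §1] -/
theorem hcOnClass_totallyRealOddPowerClass_of_ribet1983
    (hR : Ribet1983_hodgeClasses_divisorial_powers_totallyRealField_oddRelDim) :
    HCOnClass TotallyRealOddPowerClass := by
  rintro X ⟨A, hF, r, N, hA, hX⟩
  exact HodgeConjectureFor.of_isIsogenous hX (hodgeConjectureFor_powSucc_of_isTotallyRealOddWith hR hA N)

/-- **FACTOR form**: `X × Y ~ A^{N+1}` with `End⁰(A)` a totally real field of odd relative dimension ⟹ HC(`X`).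
[cite: Ribet1983, Thms. 0 and 1] [cite: vanGeemen1994HodgeAV, Lemma 3.7] -/
theorem hodgeConjectureFor_of_prod_isIsogenous_powSucc_of_ribet1983_totallyReal
    (hR : Ribet1983_hodgeClasses_divisorial_powers_totallyRealField_oddRelDim) (X Y : AbelianVariety ℂ)
    {A : AbelianVariety ℂ} {hF : IsField A.endAlgebra} {r : ℕ} (hA : IsTotallyRealOddWith A hF r) (N : ℕ)
    (hXY : AbelianVariety.IsIsogenous (X.prod Y) (A.powSucc N)) : HodgeConjectureFor X.dim X.X :=
  hodgeConjectureFor_left_of_prod X Y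
    (hcOnClass_totallyRealOddPowerClass_of_ribet1983 hR (X.prod Y) ⟨A, hF, r, N, hA, hXY⟩)

/-- **Rows `g` odd, `End⁰(A) = ℚ`** (`IsField` + `finrank = 1`; e.g. `End(A) = ℤ` in dimension `3, 5, 7`): `A` is in the
class with `r = dim A` (a degree-1 number field is totally real, tree lemma `isTotallyReal_endField_of_finrank_eq_one`),
so all powers of `A` have the Hodge property modulo Ribet's Thm. 1 — the cell's `g = 5, 7` "`End = ℤ`, all powers" rows.
[cite: Ribet1983, Thms. 0 and 1] [cite: Gordon1997, Thm. 6.3 and 10.10] -/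
theorem isTotallyRealOddWith_of_rank_one_of_odd {A : AbelianVariety ℂ} (hF : IsField A.endAlgebra)
    (h1 : Module.finrank ℚ A.endAlgebra = 1) (hodd : Odd A.dim) : IsTotallyRealOddWith A hF A.dim :=
  ⟨isTotallyReal_endField_of_finrank_eq_one hF h1, by rw [h1, one_mul], hodd⟩

/-- **Row `g = 6`, `End⁰(A)` a real quadratic field** (relative dimension `3`): in the class with `r = 3`; all powers
modulo Ribet's Thm. 1 (Literature cell `hodgeConjectureFor_powSucc_sixfold_realQuadratic_of_ribet1983`).
[cite: Ribet1983, Thms. 0 and 1] [cite: Gordon1997, Thm. 6.3] -/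
theorem isTotallyRealOddWith_sixfold_realQuadratic {A : AbelianVariety ℂ} (hA : A.dim = 6) (hF : IsField A.endAlgebra)
    (hT : NumberField.IsTotallyReal (ComplexMultiplication.EndField A hF)) (h2 : Module.finrank ℚ A.endAlgebra = 2) :
    IsTotallyRealOddWith A hF 3 :=
  ⟨hT, by rw [hA, h2], by decide⟩

/-- ON-PATH: the totally-real odd power class row is a case of `HC_AV`. [cite: Deligne2000, §1] -/
theorem hcOnClass_totallyRealOddPowerClass_of_hodgeAbelianVarieties (h : PadicSemiregularLift.HodgeAbelianVarieties) :
    HCOnClass TotallyRealOddPowerClass :=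
  fun X _ ↦ h X

/-- ON-PATH: … and of the summit. [cite: Deligne2000, §1] -/
theorem hcOnClass_totallyRealOddPowerClass_of_hodgeConjecture (h : _root_.HodgeConjecture) :
    HCOnClass TotallyRealOddPowerClass :=
  fun X _ ↦ h (AbelianVariety.isSmoothProjective_holds (A := X))

end Summit.HodgeConjecture.HodgeConjecture.Ring2.Motiv

end
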